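import Literature.AlgebraicGeometry.AbelianSchemes.DualPairHatTransitions
import Literature.AlgebraicGeometry.AbelianSchemes.DualPairOfGluedHatUnique
import HarnessLib

/-!
# Zariski gluing of dual pairs: the CHART COMPATIBILITY of the Poincaré sheaves over a glued hat
# (the one letter `hcompat` of the (Z3) P-a assembly `nonempty_dualPair_of_gluedHat_of_compat`)

Layer `Literature/AlgebraicGeometry/AbelianSchemes`, namespace `Literature.AlgebraicGeometry.AbelianSchemes.AbelianSchemeOver`.
THEOREMS ONLY (no definition, no named fact, no instance, no notation, no `sorry`).

SETTING ([MumfordFogartyKirwan1994, Ch. 6 §1 Cor. 6.8]; [BoschLutkebohmertRaynaud1990, §8.1 Prop. 4]: the rigidified Picard functor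
is a Zariski sheaf, so chartwise duals glue).  `A → S` an abelian scheme over a locally Noetherian `S`, `𝒰 = (Uᵢ → S)` an open cover,
`Dᵢ` a dual pair of `Aᵢ := A ×_S Uᵢ` on every chart, hat-normalised to `Eᵢ := chartDual i` (★ `DualPairHatTransitions`), with hats
`Êᵢ`, Poincaré sheaves `𝒫ᵢ` on `Xᵢ := Aᵢ ×_{Uᵢ} Êᵢ`, restrictions `𝒫ᵢ| := (overlapDual i j).P` to the double overlaps
`V(i,j) = Uᵢ ×_S Uⱼ` and hat transitions `θᵢⱼ : Êᵢ| → Êⱼ|` whose POINCARÉ CLAUSE is `(mᵢⱼ × θᵢⱼ)^*𝒫ⱼ| ≅ 𝒫ᵢ|`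
(`nonempty_pullback_map_hatTransition_iso`, `mᵢⱼ = overlapTransition i j`).  Let `H → S` be the GLUED HAT with its cartesian
charts `χᵢ : Êᵢ → H` and the GLUE CONDITION `θᵢⱼ ≫ pr ≫ χⱼ = pr ≫ χᵢ` (the output of `exists_gluedHat`, FILE H part 2), and
`Ξᵢ : Xᵢ → X := A ×_S H` the product charts (★ `prodChart`).

* **`nonempty_pullback_chartP_iso_of_gluedHat`** — CHART COMPATIBILITY: for every test object `b : T → H` and two chart readings
  `mᵢ : X ×_H T → Xᵢ`, `mⱼ : X ×_H T → Xⱼ` of the projection `X ×_H T → X` (`mᵢ ≫ Ξᵢ = pr = mⱼ ≫ Ξⱼ`), the pulled-back Poincaré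
  sheaves agree: `mᵢ^*𝒫ᵢ ≅ mⱼ^*𝒫ⱼ`.  This is VERBATIM the hypothesis `hcompat` of the (Z3) P-a assembly
  `nonempty_dualPair_of_gluedHat_of_compat` at `E := chartDual`, so with it `stub_F3Z` («dual pairs glue along a Zariski cover of
  the base») is `exists_gluedHat` ∘ this file ∘ that assembly.
  ROAD (no sections, no `T`-points, no classifying maps): the two readings factor JOINTLY through the overlap product
  `Y₀ := Aᵢ| ×_{V(i,j)} Êᵢ|` — there is ONE morphism `n : X ×_H T → Y₀` with `n ≫ cᵢ = mᵢ` and `n ≫ (mᵢⱼ × θᵢⱼ) ≫ cⱼ = mⱼ`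
  for the restriction charts `cᵢ : Y₀ → Xᵢ`, `cⱼ : Y₁ → Xⱼ` (★ `prodBaseChangeToProd`; the second identity is checked after the
  MONOMORPHISM `χⱼ` using the glue condition, and on the `A`-factor using `overlapTransition_comp_fst_fst` ∕ `_comp_hom`), whence
  `mᵢ^*𝒫ᵢ ≅ n^*cᵢ^*𝒫ᵢ = n^*𝒫ᵢ| ≅ n^*(mᵢⱼ × θᵢⱼ)^*𝒫ⱼ| = n^*(mᵢⱼ × θᵢⱼ)^*cⱼ^*𝒫ⱼ ≅ mⱼ^*𝒫ⱼ` (Mathlib `Scheme.Modules.pullbackComp` ∕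
  `pullbackCongr`).
* helpers: `comp_f_eq_of_chartReading` (the `Uᵢ`-coordinate of a chart reading lies over `X ×_H T → S`),
  `snd_comp_chart_eq_of_chartReading` (its `Êᵢ`-coordinate lies over `X ×_H T → H`).

Cell hodgecm-mathlib (D-0151), FLOOR 0 P1 sub-line `Cruxes/HDel/Lines/F3DualAbelianScheme.lean` stub (Z) `stub_F3Z`, job J8 of
`F0/P1c/PLAN-F0P1c.v1.1` (wave-1 prover F0P1c-p04 over B-p06 (g14)'s FILE H part 1 ∕ P-a assembly and B-p18 (g21)'s FILE H part 2).
HC_CM is proved only modulo the 7 printed citations until rung 0 closes; this file discharges none of them (count-neutral capital).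

## References
* [BoschLutkebohmertRaynaud1990] S. Bosch, W. Lütkebohmert, M. Raynaud, *Néron Models* (1990), §8.1 Prop. 4 (the rigidified Picard
  functor is a sheaf for the Zariski topology).
* [MumfordFogartyKirwan1994] D. Mumford, J. Fogarty, F. Kirwan, *Geometric Invariant Theory*, 3rd ed. (1994), Ch. 6 §1 Cor. 6.8
  (p. 118); Ch. 7 §2 Def. 7.2, Def. 7.3 (p. 129).
* [MilneAV2008] J. S. Milne, *Abelian Varieties* (v2.00, 2008), I §8 pp. 36–37.
* [GortzWedhorn2020] U. Görtz, T. Wedhorn, *Algebraic Geometry I*, 2nd ed. (2020), Prop. 4.16 (p. 101), Section (4.11).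
-/

set_option autoImplicit false

-- `Scheme.Modules` / the `Over`-structure maps of ★ `baseChange` are not reducible (as in ★ `PoincareUniversalLocality`).
set_option backward.isDefEq.respectTransparency false

noncomputable section

universe u

open CategoryTheory CategoryTheory.Limits AlgebraicGeometry MonoidalCategory
open Literature.AlgebraicGeometry.Motives Literature.AlgebraicGeometry.AbelianVarieties Literature.AlgebraicGeometry.Modules

namespace Literature.AlgebraicGeometry.AbelianSchemes

namespace AbelianSchemeOver

variable {S : Scheme.{u}} (A : AbelianSchemeOver S) (𝒰 : Scheme.OpenCover.{u} S)

/-! ### Coordinates of a chart reading -/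

section ChartReading

variable {A 𝒰} {E : ∀ i, (A.baseChange (𝒰.f i)).DualPair} {H : AbelianSchemeOver S}
  {χ : ∀ i, (E i).hat.X.left ⟶ H.X.left} (hχ : ∀ i, (E i).hat.IsBaseChangeVia H (𝒰.f i) (χ i))
  {T : Scheme.{u}} (b : T ⟶ H.X.left) (i : 𝒰.I₀)
  (m : pullback (pullback.snd A.X.hom H.X.hom) b ⟶ (A.baseChange (𝒰.f i)).prodLeft (E i).hat)
  (hm : m ≫ A.prodChart 𝒰 E H χ hχ i = pullback.fst (pullback.snd A.X.hom H.X.hom) b)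

include hm in
/-- The `A`-coordinate of a chart reading `m` of `pr : X ×_H T → X = A ×_S H` is `pr ≫ pr_A`.
[cite: MumfordFogartyKirwan1994, Ch. 7 §2 Definition 7.2 (p. 129)] -/
theorem fst_fst_of_chartReading :
    m ≫ pullback.fst (A.baseChange (𝒰.f i)).X.hom (E i).hat.X.hom ≫ pullback.fst A.X.hom (𝒰.f i) =
      pullback.fst (pullback.snd A.X.hom H.X.hom) b ≫ pullback.fst A.X.hom H.X.hom := by
  rw [← hm, Category.assoc, prodChart_fst]

include hm in
/-- The `Êᵢ`-coordinate of a chart reading lies over `X ×_H T → H`: `m ≫ pr ≫ χᵢ = pr ≫ pr_H`.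
[cite: MumfordFogartyKirwan1994, Ch. 7 §2 Definition 7.2 (p. 129)] -/
theorem snd_comp_chart_eq_of_chartReading :
    m ≫ pullback.snd (A.baseChange (𝒰.f i)).X.hom (E i).hat.X.hom ≫ χ i =
      pullback.fst (pullback.snd A.X.hom H.X.hom) b ≫ pullback.snd A.X.hom H.X.hom := by
  rw [← hm, Category.assoc, prodChart_snd]

include hm in
/-- The `Uᵢ`-coordinate of a chart reading lies over `X ×_H T → S`: `m ≫ pr ≫ (Aᵢ → Uᵢ) ≫ (Uᵢ → S) = pr ≫ pr_A ≫ (A → S)`.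
[cite: MumfordFogartyKirwan1994, Ch. 7 §2 Definition 7.2 (p. 129)] -/
theorem comp_f_eq_of_chartReading :
    (m ≫ pullback.fst (A.baseChange (𝒰.f i)).X.hom (E i).hat.X.hom ≫ pullback.snd A.X.hom (𝒰.f i)) ≫ 𝒰.f i =
      pullback.fst (pullback.snd A.X.hom H.X.hom) b ≫ pullback.fst A.X.hom H.X.hom ≫ A.X.hom := by
  rw [Category.assoc, Category.assoc, ← pullback.condition]
  simpa only [Category.assoc] using congrArg (· ≫ A.X.hom) (fst_fst_of_chartReading hχ b i m hm)

/-- On `Xᵢ = Aᵢ ×_{Uᵢ} Êᵢ` the two maps to `Uᵢ` agree: `pr_{Aᵢ} ≫ (Aᵢ → Uᵢ) = pr_{Êᵢ} ≫ (Êᵢ → Uᵢ)`.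
[cite: MumfordFogartyKirwan1994, Ch. 7 §2 Definition 7.2 (p. 129)] -/
theorem fst_snd_eq_snd_hat_hom :
    pullback.fst (A.baseChange (𝒰.f i)).X.hom (E i).hat.X.hom ≫ pullback.snd A.X.hom (𝒰.f i) =
      pullback.snd (A.baseChange (𝒰.f i)).X.hom (E i).hat.X.hom ≫ (E i).hat.X.hom :=
  pullback.condition

end ChartReading

/-! ### The chart compatibility -/

/-- **CHART COMPATIBILITY OF THE POINCARÉ SHEAVES OVER A GLUED HAT** — the letter `hcompat` of the (Z3) P-a assembly
`nonempty_dualPair_of_gluedHat_of_compat`, for the hat-normalised chart duals `Eᵢ = chartDual i`: given the glued hat `H` with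
cartesian charts `χᵢ : Êᵢ → H` and the glue condition `θᵢⱼ ≫ pr ≫ χⱼ = pr ≫ χᵢ` of the hat transitions (★-shaped `exists_gluedHat`),
ANY two chart readings `mᵢ`, `mⱼ` of `X ×_H T → X` (`mᵢ ≫ Ξᵢ = pr = mⱼ ≫ Ξⱼ`) pull the chart Poincaré sheaves back to ISOMORPHIC
modules: `mᵢ^*𝒫ᵢ ≅ mⱼ^*𝒫ⱼ`.  Proof: both readings factor through ONE morphism `n : X ×_H T → Aᵢ| ×_{V(i,j)} Êᵢ|`
(`n ≫ cᵢ = mᵢ`, `n ≫ (mᵢⱼ × θᵢⱼ) ≫ cⱼ = mⱼ` — the latter checked after the monomorphism `χⱼ` with the glue condition), and the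
POINCARÉ CLAUSE of the transition pair `(mᵢⱼ × θᵢⱼ)^*𝒫ⱼ| ≅ 𝒫ᵢ|` (`nonempty_pullback_map_hatTransition_iso`) is pulled back
along `n`. [cite: BoschLutkebohmertRaynaud1990, §8.1 Prop. 4] [cite: MumfordFogartyKirwan1994, Ch. 6 §1 Cor. 6.8 (p. 118) and Ch. 7 §2 Def. 7.3 (p. 129)]
[cite: MilneAV2008, I §8 pp. 36–37] -/
theorem nonempty_pullback_chartP_iso_of_gluedHat [IsLocallyNoetherian S] (D : ∀ i, (A.baseChange (𝒰.f i)).DualPair)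
    (H : AbelianSchemeOver S) (χ : ∀ i, (A.chartDual 𝒰 D i).hat.X.left ⟶ H.X.left)
    (hχ : ∀ i, (A.chartDual 𝒰 D i).hat.IsBaseChangeVia H (𝒰.f i) (χ i))
    (hglue : ∀ i j, A.hatTransition 𝒰 D i j ≫
        pullback.fst (A.chartDual 𝒰 D j).hat.X.hom (pullback.fst (𝒰.f j) (𝒰.f i)) ≫ χ j =
      pullback.fst (A.chartDual 𝒰 D i).hat.X.hom (pullback.fst (𝒰.f i) (𝒰.f j)) ≫ χ i)
    ⦃T : Scheme.{u}⦄ (b : T ⟶ H.X.left) (i j : 𝒰.I₀)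
    (mi : pullback (pullback.snd A.X.hom H.X.hom) b ⟶ (A.baseChange (𝒰.f i)).prodLeft (A.chartDual 𝒰 D i).hat)
    (mj : pullback (pullback.snd A.X.hom H.X.hom) b ⟶ (A.baseChange (𝒰.f j)).prodLeft (A.chartDual 𝒰 D j).hat)
    (hmi : mi ≫ A.prodChart 𝒰 (A.chartDual 𝒰 D) H χ hχ i = pullback.fst (pullback.snd A.X.hom H.X.hom) b)
    (hmj : mj ≫ A.prodChart 𝒰 (A.chartDual 𝒰 D) H χ hχ j = pullback.fst (pullback.snd A.X.hom H.X.hom) b) :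
    Nonempty ((Scheme.Modules.pullback mi).obj (A.chartDual 𝒰 D i).P ≅
      (Scheme.Modules.pullback mj).obj (A.chartDual 𝒰 D j).P) := by
  haveI : Mono (χ j) := by
    obtain ⟨w, hpb, -, -⟩ := hχ j
    haveI : IsOpenImmersion (χ j) := MorphismProperty.of_isPullback (P := @IsOpenImmersion) hpb.flip inferInstance
    infer_instance
  -- the chart families, their hats, the overlap base `V(i,j) → Uᵢ` and `V(j,i) → Uⱼ`
  let Ai : AbelianSchemeOver (𝒰.X i) := A.baseChange (𝒰.f i)
  let Aj : AbelianSchemeOver (𝒰.X j) := A.baseChange (𝒰.f j)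
  let Ei : Ai.DualPair := A.chartDual 𝒰 D i
  let Ej : Aj.DualPair := A.chartDual 𝒰 D j
  let gi : pullback (𝒰.f i) (𝒰.f j) ⟶ 𝒰.X i := pullback.fst (𝒰.f i) (𝒰.f j)
  let gj : pullback (𝒰.f j) (𝒰.f i) ⟶ 𝒰.X j := pullback.fst (𝒰.f j) (𝒰.f i)
  -- the `Uᵢ`- and `Uⱼ`-coordinates of the two readings and the induced map to `V(i,j)`
  have hu : (mi ≫ pullback.fst Ai.X.hom Ei.hat.X.hom ≫ pullback.snd A.X.hom (𝒰.f i)) ≫ 𝒰.f i =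
      (mj ≫ pullback.fst Aj.X.hom Ej.hat.X.hom ≫ pullback.snd A.X.hom (𝒰.f j)) ≫ 𝒰.f j :=
    (comp_f_eq_of_chartReading hχ b i mi hmi).trans (comp_f_eq_of_chartReading hχ b j mj hmj).symm
  let v : pullback (pullback.snd A.X.hom H.X.hom) b ⟶ pullback (𝒰.f i) (𝒰.f j) := pullback.lift _ _ hu
  have hv₁ : v ≫ gi = mi ≫ pullback.fst Ai.X.hom Ei.hat.X.hom ≫ pullback.snd A.X.hom (𝒰.f i) := pullback.lift_fst _ _ _
  have hv₂ : v ≫ pullback.snd (𝒰.f i) (𝒰.f j) = mj ≫ pullback.fst Aj.X.hom Ej.hat.X.hom ≫ pullback.snd A.X.hom (𝒰.f j) :=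
    pullback.lift_snd _ _ _
  -- the joint factorisation `n : X ×_H T → Aᵢ| ×_{V(i,j)} Êᵢ|`
  have h₁ : (mi ≫ pullback.fst Ai.X.hom Ei.hat.X.hom) ≫ Ai.X.hom = v ≫ gi := by
    rw [hv₁, Category.assoc]
    rfl
  let n₁ : pullback (pullback.snd A.X.hom H.X.hom) b ⟶ pullback Ai.X.hom gi := pullback.lift _ _ h₁
  have hn₁fst : n₁ ≫ pullback.fst Ai.X.hom gi = mi ≫ pullback.fst Ai.X.hom Ei.hat.X.hom := pullback.lift_fst _ _ _
  have hn₁snd : n₁ ≫ (A.overlapFamily 𝒰 i j).X.hom = v := pullback.lift_snd _ _ _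
  have h₂ : (mi ≫ pullback.snd Ai.X.hom Ei.hat.X.hom) ≫ Ei.hat.X.hom = v ≫ gi := by
    rw [hv₁, Category.assoc, ← fst_snd_eq_snd_hat_hom (E := A.chartDual 𝒰 D) i]
  let n₂ : pullback (pullback.snd A.X.hom H.X.hom) b ⟶ pullback Ei.hat.X.hom gi := pullback.lift _ _ h₂
  have hn₂fst : n₂ ≫ pullback.fst Ei.hat.X.hom gi = mi ≫ pullback.snd Ai.X.hom Ei.hat.X.hom := pullback.lift_fst _ _ _
  have hn₂snd : n₂ ≫ (A.overlapDual 𝒰 D i j).hat.X.hom = v := pullback.lift_snd _ _ _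
  have h₃ : n₁ ≫ (A.overlapFamily 𝒰 i j).X.hom = n₂ ≫ (A.overlapDual 𝒰 D i j).hat.X.hom := hn₁snd.trans hn₂snd.symm
  let n : pullback (pullback.snd A.X.hom H.X.hom) b ⟶ (A.overlapFamily 𝒰 i j).prodLeft (A.overlapDual 𝒰 D i j).hat :=
    pullback.lift n₁ n₂ h₃
  have hnfst : n ≫ pullback.fst (A.overlapFamily 𝒰 i j).X.hom (A.overlapDual 𝒰 D i j).hat.X.hom = n₁ :=
    pullback.lift_fst _ _ _
  have hnsnd : n ≫ pullback.snd (A.overlapFamily 𝒰 i j).X.hom (A.overlapDual 𝒰 D i j).hat.X.hom = n₂ :=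
    pullback.lift_snd _ _ _
  -- the restriction charts `cᵢ : Aᵢ| × Êᵢ| → Xᵢ`, `cⱼ`, and the transition pair `M = mᵢⱼ × θᵢⱼ`
  let ci : (A.overlapFamily 𝒰 i j).prodLeft (A.overlapDual 𝒰 D i j).hat ⟶ Ai.prodLeft Ei.hat := Ei.prodBaseChangeToProd gi
  let cj : (A.overlapFamily 𝒰 j i).prodLeft (A.overlapDual 𝒰 D j i).hat ⟶ Aj.prodLeft Ej.hat := Ej.prodBaseChangeToProd gj
  have hcifst : ci ≫ pullback.fst Ai.X.hom Ei.hat.X.hom =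
      pullback.fst (A.overlapFamily 𝒰 i j).X.hom (A.overlapDual 𝒰 D i j).hat.X.hom ≫ pullback.fst Ai.X.hom gi :=
    Ei.prodBaseChangeToProd_fst gi
  have hcisnd : ci ≫ pullback.snd Ai.X.hom Ei.hat.X.hom =
      pullback.snd (A.overlapFamily 𝒰 i j).X.hom (A.overlapDual 𝒰 D i j).hat.X.hom ≫ pullback.fst Ei.hat.X.hom gi :=
    Ei.prodBaseChangeToProd_snd gi
  have hcjfst : cj ≫ pullback.fst Aj.X.hom Ej.hat.X.hom =
      pullback.fst (A.overlapFamily 𝒰 j i).X.hom (A.overlapDual 𝒰 D j i).hat.X.hom ≫ pullback.fst Aj.X.hom gj :=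
    Ej.prodBaseChangeToProd_fst gj
  have hcjsnd : cj ≫ pullback.snd Aj.X.hom Ej.hat.X.hom =
      pullback.snd (A.overlapFamily 𝒰 j i).X.hom (A.overlapDual 𝒰 D j i).hat.X.hom ≫ pullback.fst Ej.hat.X.hom gj :=
    Ej.prodBaseChangeToProd_snd gj
  let M : (A.overlapFamily 𝒰 i j).prodLeft (A.overlapDual 𝒰 D i j).hat ⟶
      (A.overlapFamily 𝒰 j i).prodLeft (A.overlapDual 𝒰 D j i).hat :=
    pullback.map (A.overlapFamily 𝒰 i j).X.hom (A.overlapDual 𝒰 D i j).hat.X.hom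
      (A.overlapFamily 𝒰 j i).X.hom (A.overlapDual 𝒰 D j i).hat.X.hom
      (A.overlapTransition 𝒰 i j) (A.hatTransition 𝒰 D i j) (pullbackSymmetry (𝒰.f i) (𝒰.f j)).hom
      (A.overlapTransition_comp_hom 𝒰 i j).symm (A.hatTransition_comp_hom 𝒰 D i j).symm
  have hMfst : M ≫ pullback.fst (A.overlapFamily 𝒰 j i).X.hom (A.overlapDual 𝒰 D j i).hat.X.hom =
      pullback.fst (A.overlapFamily 𝒰 i j).X.hom (A.overlapDual 𝒰 D i j).hat.X.hom ≫ A.overlapTransition 𝒰 i j :=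
    pullback.lift_fst _ _ _
  have hMsnd : M ≫ pullback.snd (A.overlapFamily 𝒰 j i).X.hom (A.overlapDual 𝒰 D j i).hat.X.hom =
      pullback.snd (A.overlapFamily 𝒰 i j).X.hom (A.overlapDual 𝒰 D i j).hat.X.hom ≫ A.hatTransition 𝒰 D i j :=
    pullback.lift_snd _ _ _
  -- (1) `n ≫ cᵢ = mᵢ`
  have hnci : n ≫ ci = mi := by
    apply pullback.hom_ext
    · rw [Category.assoc, hcifst, reassoc_of% hnfst, hn₁fst]
    · rw [Category.assoc, hcisnd, reassoc_of% hnsnd, hn₂fst]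
  -- (2) `n ≫ M ≫ cⱼ = mⱼ`
  have hnMcj : n ≫ M ≫ cj = mj := by
    apply pullback.hom_ext
    · -- the `Aⱼ`-coordinate: compare in `A` and in `Uⱼ`
      rw [Category.assoc, Category.assoc, hcjfst, reassoc_of% hMfst, reassoc_of% hnfst]
      apply pullback.hom_ext
      · rw [Category.assoc, Category.assoc, Category.assoc, A.overlapTransition_comp_fst_fst 𝒰 i j, reassoc_of% hn₁fst,
          fst_fst_of_chartReading hχ b i mi hmi, fst_fst_of_chartReading hχ b j mj hmj]
      · have e1 : pullback.fst Aj.X.hom gj ≫ pullback.snd A.X.hom (𝒰.f j) =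
            (A.overlapFamily 𝒰 j i).X.hom ≫ pullback.fst (𝒰.f j) (𝒰.f i) := pullback.condition
        rw [Category.assoc, Category.assoc, Category.assoc, e1, A.overlapTransition_comp_hom_assoc 𝒰 i j,
          pullbackSymmetry_hom_comp_fst, reassoc_of% hn₁snd, hv₂]
    · -- the `Êⱼ`-coordinate: after the monomorphism `χⱼ`, by the glue condition
      rw [← cancel_mono (χ j), Category.assoc, Category.assoc, Category.assoc, Category.assoc, reassoc_of% hcjsnd,
        reassoc_of% hMsnd,
        reassoc_of% hnsnd, hglue i j, reassoc_of% hn₂fst,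
        snd_comp_chart_eq_of_chartReading hχ b i mi hmi, snd_comp_chart_eq_of_chartReading hχ b j mj hmj]
  -- (3) the Poincaré clause of the transition pair, pulled back along `n`
  obtain ⟨e₀⟩ := A.nonempty_pullback_map_hatTransition_iso 𝒰 D i j
  have ePi : (A.overlapDual 𝒰 D i j).P = (Scheme.Modules.pullback ci).obj Ei.P := rfl
  have ePj : (A.overlapDual 𝒰 D j i).P = (Scheme.Modules.pullback cj).obj Ej.P := rfl
  exact ⟨(Scheme.Modules.pullbackCongr hnci.symm).app Ei.P ≪≫ ((Scheme.Modules.pullbackComp n ci).app Ei.P).symm ≪≫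
    (Scheme.Modules.pullback n).mapIso (eqToIso ePi.symm ≪≫ e₀.symm ≪≫
      (Scheme.Modules.pullback M).mapIso (eqToIso ePj) ≪≫ (Scheme.Modules.pullbackComp M cj).app Ej.P) ≪≫
    (Scheme.Modules.pullbackComp n (M ≫ cj)).app Ej.P ≪≫ (Scheme.Modules.pullbackCongr hnMcj).app Ej.P⟩

end AbelianSchemeOver

end Literature.AlgebraicGeometry.AbelianSchemes

end
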